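import Mathlib
import Literature.MathematicalPhysics.StatisticalMechanics.BarlowStacking
import Literature.Barriers.AtomisticToContinuum.LocalizedPotentialsExcludeLennardJones
import Literature.Barriers.AtomisticToContinuum.ShortRangeStackingBlindnessProofs
import HarnessLib

/-!
# Flatley–Theil's lattice `𝓛_fcc = (b₁ b₂ b₃) ℤ³` is the `…ABCABC…` close-packed stacking; its
# shell counts `m(1) = 12`, `m(√2) = 6`, `m(√3) = 24`

Topic `Literature/MathematicalPhysics/StatisticalMechanics`; a vocabulary bridge between the two
fcc objects of the tree, both with nearest-neighbour distance `1`: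

* `Literature.Barriers.AtomisticToContinuum.FlatleyTheil2015.fccLattice` — Flatley–Theil's
  `𝓛_fcc = (b₁ b₂ b₃) ℤ³`, `b₁ = (0,1,1)/√2`, `b₂ = (1,0,1)/√2`, `b₃ = (1,1,0)/√2`
  [cite: FlatleyTheil2015, §1 (arXiv p. 3)], the lattice of `FlatleyTheil2015_prop31`,
  `FlatleyTheil2015_thm11`, `fccEnergy`;
* `Literature.MathematicalPhysics.StatisticalMechanics.fccStacking 1 √(2/3)` — the Barlow stacking
  of triangular layers with the constant Hägg sequence (`…ABCABC…`), the fcc object of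
  `ShortRangeStackingBlindness.lean`, `LayerShellPatterns.lean` and of the Conway–Sloane shell
  counts `ConwaySloane1999_fccShells`.

Flatley–Theil use the layer description of `𝓛_fcc` in §3.2: "we recall that `𝓛` can be written as
unions of layers of triangular lattices" [cite: FlatleyTheil2015, §3.2 (p. 10)]; Conway–Sloane,
Ch. 1 §1.3: the layer sequence `…abcabc…` produces the face-centred cubic lattice.

## Main statements

* `FlatleyTheil2015.exists_linearIsometryEquiv_image_fccLattice` — there is a linear isometry
  `A` of `ℝ³` with `A '' 𝓛_fcc = fccStacking 1 √(2/3)`: the frame `b₁, b₂, b₃` and the layer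
  frame `w + h e₃ = (1/2, √3/6, √(2/3))`, `v = (1/2, √3/2, 0)`, `u = (1, 0, 0)` have the same Gram
  matrix (`1` on the diagonal, `1/2` off it), so `bᵢ ↦` layer frame extends to a linear isometry,
  and `a₁ b₁ + a₂ b₂ + a₃ b₃ ↦ a₃ u + a₂ v + a₁ (w + h e₃) = barlowPos 1 h constHagg a₁ a₃ a₂`
  (`haggLabel constHagg k = k`).
* `FlatleyTheil2015.shellCount` — `m(λ) = #{η ∈ 𝓛_fcc : |η| = λ}`
  [cite: FlatleyTheil2015, (eq:mldefn), p. 15] — and `FlatleyTheil2015.shellCount_values`: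
  `m(1) = 12`, `m(√2) = 6`, `m(√3) = 24` (and `m(2) = 12`), the first line of the proof of
  Lemma 5.8 [cite: FlatleyTheil2015, Appendix, proof of Lemma 5.8, p. 25], transported through `A`
  from `ConwaySloane1999_fccShells_holds`; `FlatleyTheil2015.ncard_sphere_fccLattice` is the
  translated form around any lattice point.

* (v2) `FlatleyTheil2015.shellCount_eq_zero_of_not_mem`, `shellCount_sqrt_eleven_thirds` —
  `m(√(11/3)) = 0`: the display defining `Λ` on p. 14 lists `√(11/3)` among the distances of
  `𝓛_fcc`, a misprint (PRINT NOTE in the docstring);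
  `exists_linearIsometryEquiv_image_fccLattice_detOne` (the isometry in `SO(3)`, since
  `𝓛_fcc = −𝓛_fcc`).

No named fact; two definitions with bodies (`layerFrame`, `shellCount`) (D-0026).
-/

noncomputable section

open Literature.Barriers.AtomisticToContinuum.FlatleyTheil2015 (fccPoint fccVec fccLattice Space
  fccPoint_eq_sum fccPoint_injective)
open Literature.MathematicalPhysics.StatisticalMechanics (fccStacking barlowStacking barlowPos
  constHagg triangularVec₁ triangularVec₂ barlowOffset layerNormal haggLabel_const)

namespace Literature.MathematicalPhysics.StatisticalMechanics

namespace FlatleyTheil2015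

/-- The layer frame of the `…ABCABC…` stacking with in-layer spacing `1` and layer spacing
`h = √(2/3)`, indexed to match `b₁, b₂, b₃`: `f₀ = w + h e₃ = (1/2, √3/6, √(2/3))` (the step to
the next layer), `f₁ = v = (1/2, √3/2, 0)`, `f₂ = u = (1, 0, 0)`.
[cite: ConwaySloane1999, Ch. 1 §1.3] -/
def layerFrame : Fin 3 → EuclideanSpace ℝ (Fin 3) :=
  ![barlowOffset 1 + layerNormal (Real.sqrt (2 / 3)), triangularVec₂ 1, triangularVec₁ 1]

/-- Gram matrix of `b₁, b₂, b₃`: `⟪bᵢ, bⱼ⟫ = 1` if `i = j`, `1/2` otherwise. [folklore] -/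
private theorem inner_fccVec (i j : Fin 3) :
    inner ℝ (fccVec i) (fccVec j) = if i = j then (1 : ℝ) else 1 / 2 := by
  have hs : (Real.sqrt 2)⁻¹ * (Real.sqrt 2)⁻¹ = 2⁻¹ := by
    rw [← mul_inv, Real.mul_self_sqrt (by norm_num)]
  fin_cases i <;> fin_cases j <;>
    simp only [PiLp.inner_apply, RCLike.inner_apply, conj_trivial, Fin.sum_univ_three] <;>
    simp [fccVec] <;> linarith [hs]

/-- Gram matrix of the layer frame: the same. [folklore] -/
private theorem inner_layerFrame (i j : Fin 3) :
    inner ℝ (layerFrame i) (layerFrame j) = if i = j then (1 : ℝ) else 1 / 2 := by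
  have h2 : Real.sqrt 2 ^ 2 = 2 := Real.sq_sqrt (by norm_num)
  have h3 : Real.sqrt 3 ^ 2 = 3 := Real.sq_sqrt (by norm_num)
  fin_cases i <;> fin_cases j <;>
    simp only [PiLp.inner_apply, RCLike.inner_apply, conj_trivial, Fin.sum_univ_three] <;>
    simp [layerFrame, barlowOffset, layerNormal, triangularVec₁, triangularVec₂] <;>
    field_simp <;> nlinarith [h2, h3]

/-- `b₁, b₂, b₃` are linearly independent. [folklore] -/
private theorem linearIndependent_fccVec : LinearIndependent ℝ fccVec := by
  rw [Fintype.linearIndependent_iff]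
  intro g hg
  have hs : (0 : ℝ) < (Real.sqrt 2)⁻¹ := by positivity
  have e0 := congrArg (fun v : EuclideanSpace ℝ (Fin 3) => v 0) hg
  have e1 := congrArg (fun v : EuclideanSpace ℝ (Fin 3) => v 1) hg
  have e2 := congrArg (fun v : EuclideanSpace ℝ (Fin 3) => v 2) hg
  simp [Fin.sum_univ_three, fccVec] at e0 e1 e2
  have h0 : (g 1 + g 2) * (Real.sqrt 2)⁻¹ = 0 := by linarith [e0]
  have h1 : (g 0 + g 2) * (Real.sqrt 2)⁻¹ = 0 := by linarith [e1]
  have h2 : (g 0 + g 1) * (Real.sqrt 2)⁻¹ = 0 := by linarith [e2]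
  have h0' := (mul_eq_zero.1 h0).resolve_right hs.ne'
  have h1' := (mul_eq_zero.1 h1).resolve_right hs.ne'
  have h2' := (mul_eq_zero.1 h2).resolve_right hs.ne'
  intro i
  fin_cases i <;> simp <;> linarith

/-- The basis `b₁, b₂, b₃` of `ℝ³`. [folklore] -/
private def fccBasis : Module.Basis (Fin 3) ℝ (EuclideanSpace ℝ (Fin 3)) :=
  basisOfLinearIndependentOfCardEqFinrank linearIndependent_fccVec (by simp)

/-- The basis vectors are `b₁, b₂, b₃`. [folklore] -/
private theorem fccBasis_apply (i : Fin 3) : fccBasis i = fccVec i :=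
  congrFun (coe_basisOfLinearIndependentOfCardEqFinrank linearIndependent_fccVec _) i

/-- **`𝓛_fcc` is the `…ABCABC…` stacking up to a rotation:** there is a linear isometry `A` of
`ℝ³` with `A(𝓛_fcc) = fccStacking 1 √(2/3)` (in-layer spacing `1`, ideal layer spacing `√(2/3)`,
constant Hägg sequence). [cite: FlatleyTheil2015, §3.2 (p. 10: "𝓛 can be written as unions of
layers of triangular lattices")] [cite: ConwaySloane1999, Ch. 1 §1.3] -/
theorem exists_linearIsometryEquiv_image_fccLattice :
    ∃ A : EuclideanSpace ℝ (Fin 3) ≃ₗᵢ[ℝ] EuclideanSpace ℝ (Fin 3),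
      A '' fccLattice = fccStacking 1 (Real.sqrt (2 / 3)) := by
  classical
  let L : EuclideanSpace ℝ (Fin 3) →ₗ[ℝ] EuclideanSpace ℝ (Fin 3) := fccBasis.constr ℝ layerFrame
  have hL : ∀ i, L (fccVec i) = layerFrame i := fun i => by
    rw [← fccBasis_apply]; exact fccBasis.constr_basis ℝ layerFrame i
  have hinner : ∀ x y, inner ℝ (L x) (L y) = inner ℝ x y := by
    have key : LinearMap.BilinForm.comp (innerₗ (EuclideanSpace ℝ (Fin 3))) L L =
        innerₗ (EuclideanSpace ℝ (Fin 3)) := by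
      refine LinearMap.BilinForm.ext_basis fccBasis fun i j => ?_
      rw [LinearMap.BilinForm.comp_apply, innerₗ_apply_apply, innerₗ_apply_apply, fccBasis_apply,
        fccBasis_apply, hL, hL, inner_layerFrame, inner_fccVec]
    intro x y
    have := congrArg (fun B : LinearMap.BilinForm ℝ (EuclideanSpace ℝ (Fin 3)) => B x y) key
    simpa only [LinearMap.BilinForm.comp_apply, innerₗ_apply_apply] using this
  let A₀ : EuclideanSpace ℝ (Fin 3) →ₗᵢ[ℝ] EuclideanSpace ℝ (Fin 3) := L.isometryOfInner hinner
  let A : EuclideanSpace ℝ (Fin 3) ≃ₗᵢ[ℝ] EuclideanSpace ℝ (Fin 3) :=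
    A₀.toLinearIsometryEquiv rfl
  have hA : ∀ x, A x = L x := fun x => by
    show (A₀.toLinearIsometryEquiv rfl) x = L x
    rw [LinearIsometry.toLinearIsometryEquiv_apply]
    rfl
  have hl0 : layerFrame 0 = barlowOffset 1 + layerNormal (Real.sqrt (2 / 3)) := rfl
  have hl1 : layerFrame 1 = triangularVec₂ 1 := rfl
  have hl2 : layerFrame 2 = triangularVec₁ 1 := rfl
  have hApt : ∀ a : Fin 3 → ℤ, A (fccPoint a) =
      (a 0 : ℝ) • layerFrame 0 + (a 1 : ℝ) • layerFrame 1 + (a 2 : ℝ) • layerFrame 2 := by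
    intro a
    rw [hA, fccPoint_eq_sum]
    simp only [Fin.sum_univ_three, map_add, map_smul, hL]
  have hpos : ∀ k i j : ℤ, barlowPos 1 (Real.sqrt (2 / 3)) constHagg k i j =
      (k : ℝ) • layerFrame 0 + (j : ℝ) • layerFrame 1 + (i : ℝ) • layerFrame 2 := by
    intro k i j
    rw [hl0, hl1, hl2, barlowPos, haggLabel_const, smul_add]
    abel
  refine ⟨A, Set.Subset.antisymm ?_ ?_⟩
  · rintro _ ⟨z, ⟨a, rfl⟩, rfl⟩
    show A (fccPoint a) ∈ barlowStacking 1 _ constHagg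
    rw [mem_barlowStacking_iff]
    exact ⟨a 0, a 2, a 1, by rw [hApt, hpos]⟩
  · intro x hx
    change x ∈ barlowStacking 1 _ constHagg at hx
    obtain ⟨k, i, j, rfl⟩ := mem_barlowStacking_iff.1 hx
    refine ⟨fccPoint ![k, j, i], ⟨_, rfl⟩, ?_⟩
    rw [hApt, hpos]
    simp

/-- **`m(λ) = #{η ∈ 𝓛_fcc : |η| = λ}`**, the number of lattice points at distance `λ` from the
origin. [cite: FlatleyTheil2015, (eq:mldefn), p. 15] -/
def shellCount (l : ℝ) : ℕ := (fccLattice ∩ Metric.sphere (0 : EuclideanSpace ℝ (Fin 3)) l).ncard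

/-- Shell counts around an arbitrary point of `𝓛_fcc`, transported from Conway–Sloane's theta
series of fcc through the isometry of `exists_linearIsometryEquiv_image_fccLattice`: `12, 6, 24,
12` points at distances `1, √2, √3, 2`, and no other distance `≤ 2`.
[cite: ConwaySloane1999, Ch. 4 §6.3 (66) and Table 4.5] [cite: FlatleyTheil2015, Appendix,
proof of Lemma 5.8, p. 25 ("m(1) = 12, m(√2) = 6, m(√3) = 24")] -/
theorem ncard_sphere_fccLattice {z : EuclideanSpace ℝ (Fin 3)} (hz : z ∈ fccLattice) :
    (fccLattice ∩ Metric.sphere z 1).ncard = 12 ∧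
    (fccLattice ∩ Metric.sphere z (Real.sqrt 2)).ncard = 6 ∧
    (fccLattice ∩ Metric.sphere z (Real.sqrt 3)).ncard = 24 ∧
    (fccLattice ∩ Metric.sphere z 2).ncard = 12 ∧
    ∀ z' ∈ fccLattice, dist z z' ≤ 2 →
      dist z z' ∈ ({0, 1, Real.sqrt 2, Real.sqrt 3, 2} : Set ℝ) := by
  obtain ⟨A, hA⟩ := exists_linearIsometryEquiv_image_fccLattice
  have hAz : A z ∈ fccStacking 1 (Real.sqrt (2 / 3)) := hA ▸ Set.mem_image_of_mem _ hz
  obtain ⟨h1, h2, h3, h4, h5⟩ :=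
    Literature.Barriers.AtomisticToContinuum.ConwaySloane1999_fccShells_holds (A z) hAz
  have himg : ∀ r : ℝ, A '' (fccLattice ∩ Metric.sphere z r) =
      fccStacking 1 (Real.sqrt (2 / 3)) ∩ Metric.sphere (A z) r := by
    intro r
    rw [Set.image_inter A.injective, hA]
    congr 1
    ext w
    simp only [Set.mem_image, Metric.mem_sphere]
    constructor
    · rintro ⟨w', hw', rfl⟩
      rwa [A.dist_map]
    · intro hw
      refine ⟨A.symm w, ?_, A.apply_symm_apply w⟩
      rwa [← A.dist_map, A.apply_symm_apply]
  have hnc : ∀ r : ℝ, (fccLattice ∩ Metric.sphere z r).ncard =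
      (fccStacking 1 (Real.sqrt (2 / 3)) ∩ Metric.sphere (A z) r).ncard := fun r => by
    rw [← himg, Set.ncard_image_of_injective _ A.injective]
  refine ⟨(hnc 1).trans h1, (hnc _).trans h2, (hnc _).trans h3, (hnc 2).trans h4, ?_⟩
  intro z' hz' hd
  have hAz' : A z' ∈ fccStacking 1 (Real.sqrt (2 / 3)) := hA ▸ Set.mem_image_of_mem _ hz'
  have := h5 (A z') hAz' (by rwa [A.dist_map])
  rwa [A.dist_map] at this

/-- **`m(1) = 12`, `m(√2) = 6`, `m(√3) = 24`** (and `m(2) = 12`).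
[cite: FlatleyTheil2015, Appendix, proof of Lemma 5.8, p. 25] -/
theorem shellCount_values :
    shellCount 1 = 12 ∧ shellCount (Real.sqrt 2) = 6 ∧ shellCount (Real.sqrt 3) = 24 ∧
      shellCount 2 = 12 := by
  have h0 : (0 : EuclideanSpace ℝ (Fin 3)) ∈ fccLattice := ⟨0, map_zero fccPoint⟩
  obtain ⟨h1, h2, h3, h4, -⟩ := ncard_sphere_fccLattice h0
  exact ⟨h1, h2, h3, h4⟩

/-- `√(8/3)` is not a distance of `𝓛_fcc`: `m(√(8/3)) = 0` (the one medium distance which is not a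
lattice distance, "`Λ_med ∖ Λ = {√(8/3)}`"). [cite: FlatleyTheil2015, §5 (p. 14)] -/
theorem shellCount_sqrt_eight_thirds : shellCount (Real.sqrt (8 / 3)) = 0 := by
  have h0 : (0 : EuclideanSpace ℝ (Fin 3)) ∈ fccLattice := ⟨0, map_zero fccPoint⟩
  obtain ⟨-, -, -, -, h5⟩ := ncard_sphere_fccLattice h0
  have hsq : Real.sqrt (8 / 3) ^ 2 = 8 / 3 := Real.sq_sqrt (by norm_num)
  have hle : Real.sqrt (8 / 3) ≤ 2 := by
    rw [show (2 : ℝ) = Real.sqrt (2 ^ 2) by rw [Real.sqrt_sq (by norm_num)]]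
    exact Real.sqrt_le_sqrt (by norm_num)
  have hempty : fccLattice ∩ Metric.sphere (0 : EuclideanSpace ℝ (Fin 3)) (Real.sqrt (8 / 3)) = ∅ := by
    ext w
    simp only [Set.mem_inter_iff, Metric.mem_sphere, Set.mem_empty_iff_false, iff_false, not_and]
    intro hw hdist
    have hmem := h5 w hw (by rw [dist_comm, hdist]; exact hle)
    rw [dist_comm, hdist] at hmem
    simp only [Set.mem_insert_iff, Set.mem_singleton_iff] at hmem
    rcases hmem with h | h | h | h | h
    · rw [h] at hsq; norm_num at hsq
    · rw [h] at hsq; norm_num at hsq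
    · rw [h, Real.sq_sqrt (by norm_num)] at hsq; norm_num at hsq
    · rw [h, Real.sq_sqrt (by norm_num)] at hsq; norm_num at hsq
    · rw [h] at hsq; norm_num at hsq
  rw [shellCount, hempty, Set.ncard_empty]

/-- A radius `l ≤ 2` outside `{0, 1, √2, √3, 2}` carries no point of `𝓛_fcc`. [cite: ConwaySloane1999,
Ch. 4 §6.3 (66) and Table 4.5 (no other norm `≤ 8` in `D₃`)] -/
theorem shellCount_eq_zero_of_not_mem {l : ℝ} (hl : l ≤ 2)
    (hne : l ∉ ({0, 1, Real.sqrt 2, Real.sqrt 3, 2} : Set ℝ)) : shellCount l = 0 := by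
  have h0 : (0 : EuclideanSpace ℝ (Fin 3)) ∈ fccLattice := ⟨0, map_zero fccPoint⟩
  obtain ⟨-, -, -, -, h5⟩ := ncard_sphere_fccLattice h0
  have hempty : fccLattice ∩ Metric.sphere (0 : EuclideanSpace ℝ (Fin 3)) l = ∅ := by
    ext w
    simp only [Set.mem_inter_iff, Metric.mem_sphere, Set.mem_empty_iff_false, iff_false, not_and]
    intro hw hdist
    have hmem := h5 w hw (by rw [dist_comm, hdist]; exact hl)
    rw [dist_comm, hdist] at hmem
    exact hne hmem
  rw [shellCount, hempty, Set.ncard_empty]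

/-- **PRINT NOTE (misprint in the display defining `Λ`, p. 14):** "`Λ = {|z| : z ∈ 𝓛_fcc} =
{1, √2, √3, √(11/3), …}`" — but `√(11/3)` is not a distance of `𝓛_fcc` (its square is not an
integer, whereas `|z|² ∈ ℕ` on `𝓛_fcc = D₃/√2`; `√(11/3)` is a distance of the hcp structure,
Conway–Sloane Table 4.6): `m(√(11/3)) = 0`. The intended list is `{1, √2, √3, 2, √5, …}`; the
paper only uses `Λ` through `Λ_long = Λ ∩ (√3, ∞)` and `m(λ)`, so nothing else is affected.
[cite: FlatleyTheil2015, §5 (p. 14, display (Λ))] [cite: ConwaySloane1999, Ch. 4 §6.3, §6.5] -/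
theorem shellCount_sqrt_eleven_thirds : shellCount (Real.sqrt (11 / 3)) = 0 := by
  have hsq : Real.sqrt (11 / 3) ^ 2 = 11 / 3 := Real.sq_sqrt (by norm_num)
  refine shellCount_eq_zero_of_not_mem ?_ ?_
  · rw [show (2 : ℝ) = Real.sqrt (2 ^ 2) by rw [Real.sqrt_sq (by norm_num)]]
    exact Real.sqrt_le_sqrt (by norm_num)
  · simp only [Set.mem_insert_iff, Set.mem_singleton_iff, not_or]
    refine ⟨fun h => ?_, fun h => ?_, fun h => ?_, fun h => ?_, fun h => ?_⟩
    · rw [h] at hsq; norm_num at hsq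
    · rw [h] at hsq; norm_num at hsq
    · rw [h, Real.sq_sqrt (by norm_num)] at hsq; norm_num at hsq
    · rw [h, Real.sq_sqrt (by norm_num)] at hsq; norm_num at hsq
    · rw [h] at hsq; norm_num at hsq

/-- `𝓛_fcc` is centrally symmetric: `−𝓛_fcc = 𝓛_fcc`. [folklore] -/
private theorem neg_mem_fccLattice {z : EuclideanSpace ℝ (Fin 3)} (hz : z ∈ fccLattice) :
    -z ∈ fccLattice := by
  obtain ⟨a, rfl⟩ := hz
  exact ⟨-a, map_neg fccPoint a⟩

/-- The isometry of `exists_linearIsometryEquiv_image_fccLattice` may be taken in `SO(3)`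
(because `𝓛_fcc = −𝓛_fcc`), matching the paper's rigid motions `z₀ + R 𝓛`, `R ∈ SO(3)`.
[cite: FlatleyTheil2015, §3.2 (p. 10)] [cite: ConwaySloane1999, Ch. 1 §1.3] -/
theorem exists_linearIsometryEquiv_image_fccLattice_detOne :
    ∃ A : EuclideanSpace ℝ (Fin 3) ≃ₗᵢ[ℝ] EuclideanSpace ℝ (Fin 3),
      LinearMap.det (A.toLinearEquiv : EuclideanSpace ℝ (Fin 3) →ₗ[ℝ] EuclideanSpace ℝ (Fin 3)) = 1 ∧
      A '' fccLattice = fccStacking 1 (Real.sqrt (2 / 3)) := by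
  obtain ⟨A, hA⟩ := exists_linearIsometryEquiv_image_fccLattice
  have habs : |LinearMap.det (A.toLinearEquiv :
      EuclideanSpace ℝ (Fin 3) →ₗ[ℝ] EuclideanSpace ℝ (Fin 3))| = 1 := by
    rw [← LinearMap.normDet_eq_abs_det]
    exact A.toLinearIsometry.normDet_eq_one
  rcases (abs_eq (zero_le_one' ℝ)).1 habs with hdet | hdet
  · exact ⟨A, hdet, hA⟩
  let N : EuclideanSpace ℝ (Fin 3) ≃ₗᵢ[ℝ] EuclideanSpace ℝ (Fin 3) := LinearIsometryEquiv.neg ℝ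
  have hN : (N.toLinearEquiv : EuclideanSpace ℝ (Fin 3) →ₗ[ℝ] EuclideanSpace ℝ (Fin 3)) =
      (-1 : ℝ) • LinearMap.id := by
    ext x; simp [N]
  refine ⟨N.trans A, ?_, ?_⟩
  · have hcomp : ((N.trans A).toLinearEquiv :
        EuclideanSpace ℝ (Fin 3) →ₗ[ℝ] EuclideanSpace ℝ (Fin 3)) =
        (A.toLinearEquiv : EuclideanSpace ℝ (Fin 3) →ₗ[ℝ] EuclideanSpace ℝ (Fin 3)).comp
          (N.toLinearEquiv : EuclideanSpace ℝ (Fin 3) →ₗ[ℝ] EuclideanSpace ℝ (Fin 3)) := rfl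
    rw [hcomp, LinearMap.det_comp, hdet, hN, LinearMap.det_smul, LinearMap.det_id,
      finrank_euclideanSpace_fin]
    norm_num
  · rw [← hA]
    ext w
    simp only [Set.mem_image, LinearIsometryEquiv.trans_apply]
    constructor
    · rintro ⟨z, hz, rfl⟩
      exact ⟨-z, neg_mem_fccLattice hz, by simp [N]⟩
    · rintro ⟨z, hz, rfl⟩
      exact ⟨-z, neg_mem_fccLattice hz, by simp [N]⟩

/-- **`𝓛_fcc` is the `…ABCABC…` stacking up to a rotation, WITH THE LAYER STRUCTURE**: there is a
linear isometry `A` of `ℝ³` mapping the lattice point `a₁ b₁ + a₂ b₂ + a₃ b₃` to the point `(i, j) =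
(a₃, a₂)` of LAYER `k = a₁` of `fccStacking 1 √(2/3)` — so the coefficient of `b₁` is the layer index
(height `a₁ √(2/3)`), the close-packed planes of the lattice presentation being `{a₁ = const}` — and
`A(𝓛_fcc) = fccStacking 1 √(2/3)`.  (Same isometry as `exists_linearIsometryEquiv_image_fccLattice`;
this form exposes the layer bookkeeping needed by bilayer-wise arguments.)
[cite: FlatleyTheil2015, §3.2 (p. 10: "𝓛 can be written as unions of layers of triangular
lattices")] [cite: ConwaySloane1999, Ch. 1 §1.3] -/
theorem exists_linearIsometryEquiv_fccLattice_layers :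
    ∃ A : EuclideanSpace ℝ (Fin 3) ≃ₗᵢ[ℝ] EuclideanSpace ℝ (Fin 3),
      (∀ a : Fin 3 → ℤ, A (fccPoint a) = barlowPos 1 (Real.sqrt (2 / 3)) constHagg (a 0) (a 2) (a 1)) ∧
      A '' fccLattice = fccStacking 1 (Real.sqrt (2 / 3)) := by
  classical
  let L : EuclideanSpace ℝ (Fin 3) →ₗ[ℝ] EuclideanSpace ℝ (Fin 3) := fccBasis.constr ℝ layerFrame
  have hL : ∀ i, L (fccVec i) = layerFrame i := fun i => by
    rw [← fccBasis_apply]; exact fccBasis.constr_basis ℝ layerFrame i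
  have hinner : ∀ x y, inner ℝ (L x) (L y) = inner ℝ x y := by
    have key : LinearMap.BilinForm.comp (innerₗ (EuclideanSpace ℝ (Fin 3))) L L =
        innerₗ (EuclideanSpace ℝ (Fin 3)) := by
      refine LinearMap.BilinForm.ext_basis fccBasis fun i j => ?_
      rw [LinearMap.BilinForm.comp_apply, innerₗ_apply_apply, innerₗ_apply_apply, fccBasis_apply,
        fccBasis_apply, hL, hL, inner_layerFrame, inner_fccVec]
    intro x y
    have := congrArg (fun B : LinearMap.BilinForm ℝ (EuclideanSpace ℝ (Fin 3)) => B x y) key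
    simpa only [LinearMap.BilinForm.comp_apply, innerₗ_apply_apply] using this
  let A₀ : EuclideanSpace ℝ (Fin 3) →ₗᵢ[ℝ] EuclideanSpace ℝ (Fin 3) := L.isometryOfInner hinner
  let A : EuclideanSpace ℝ (Fin 3) ≃ₗᵢ[ℝ] EuclideanSpace ℝ (Fin 3) :=
    A₀.toLinearIsometryEquiv rfl
  have hA : ∀ x, A x = L x := fun x => by
    show (A₀.toLinearIsometryEquiv rfl) x = L x
    rw [LinearIsometry.toLinearIsometryEquiv_apply]
    rfl
  have hl0 : layerFrame 0 = barlowOffset 1 + layerNormal (Real.sqrt (2 / 3)) := rfl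
  have hl1 : layerFrame 1 = triangularVec₂ 1 := rfl
  have hl2 : layerFrame 2 = triangularVec₁ 1 := rfl
  have hApt : ∀ a : Fin 3 → ℤ, A (fccPoint a) =
      (a 0 : ℝ) • layerFrame 0 + (a 1 : ℝ) • layerFrame 1 + (a 2 : ℝ) • layerFrame 2 := by
    intro a
    rw [hA, fccPoint_eq_sum]
    simp only [Fin.sum_univ_three, map_add, map_smul, hL]
  have hpos : ∀ k i j : ℤ, barlowPos 1 (Real.sqrt (2 / 3)) constHagg k i j =
      (k : ℝ) • layerFrame 0 + (j : ℝ) • layerFrame 1 + (i : ℝ) • layerFrame 2 := by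
    intro k i j
    rw [hl0, hl1, hl2, barlowPos, haggLabel_const, smul_add]
    abel
  have hlay : ∀ a : Fin 3 → ℤ,
      A (fccPoint a) = barlowPos 1 (Real.sqrt (2 / 3)) constHagg (a 0) (a 2) (a 1) := by
    intro a; rw [hApt, hpos]
  refine ⟨A, hlay, Set.Subset.antisymm ?_ ?_⟩
  · rintro _ ⟨z, ⟨a, rfl⟩, rfl⟩
    rw [hlay]
    exact barlowPos_mem _ _ _
  · intro x hx
    change x ∈ barlowStacking 1 _ constHagg at hx
    obtain ⟨k, i, j, rfl⟩ := mem_barlowStacking_iff.1 hx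
    refine ⟨fccPoint ![k, j, i], ⟨_, rfl⟩, ?_⟩
    rw [hlay]
    simp

/-- Corollary: under the isometry of `exists_linearIsometryEquiv_fccLattice_layers` the lattice point
`a₁ b₁ + a₂ b₂ + a₃ b₃` lies in LAYER `a₁` of the stacking (height `a₁ √(2/3)`).
[cite: FlatleyTheil2015, §3.2 (p. 10)] -/
theorem exists_linearIsometryEquiv_fccLattice_mem_layer :
    ∃ A : EuclideanSpace ℝ (Fin 3) ≃ₗᵢ[ℝ] EuclideanSpace ℝ (Fin 3),
      (∀ a : Fin 3 → ℤ, A (fccPoint a) ∈ barlowLayer 1 (Real.sqrt (2 / 3)) constHagg (a 0)) ∧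
      (∀ a : Fin 3 → ℤ, A (fccPoint a) 2 = (a 0 : ℝ) * Real.sqrt (2 / 3)) ∧
      A '' fccLattice = fccStacking 1 (Real.sqrt (2 / 3)) := by
  obtain ⟨A, hlay, himg⟩ := exists_linearIsometryEquiv_fccLattice_layers
  refine ⟨A, fun a => ⟨a 2, a 1, hlay a⟩, fun a => ?_, himg⟩
  rw [hlay, barlowPos_apply_two]

#harness_tags exists_linearIsometryEquiv_image_fccLattice
#harness_tags exists_linearIsometryEquiv_fccLattice_layers
#harness_tags shellCount_sqrt_eleven_thirds
#harness_tags exists_linearIsometryEquiv_image_fccLattice_detOne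
#harness_tags shellCount_values
#harness_tags ncard_sphere_fccLattice

end FlatleyTheil2015

end Literature.MathematicalPhysics.StatisticalMechanics
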